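import Mathlib

/-!
# `Balaban1983to89.B8HessianSupWitness` — a kernel-checked lattice witness for the quantitative half of the
# cell's objection G-B8-13 to Theorem 8 of B8: no scale-uniform sup-norm bound of mixed second differences
# by the lattice Laplacian (logarithmic growth in the number of scales)
# v1.1 (§7, append-only): + the Hölder clause of (1.36) under the same sources — power-law failure `N^β`; and the
# gradient of the source versus the source (ratio `N`)
# v1.2 (ERRATUM — docstrings + §8; every v1/v1.1 declaration untouched): v1.1 ALSO labelled its `∂ ∘ lap` lemmas
# «the `Δ`-clause of (1.39)» and withdrew a gen-1 aside on (1.39) — RETRACTED: on bond functions the operators of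
# (1.39) are the covariant curl–curl `D*D` and the Wilson-action Hessian `Δ^η(U₀) = D*D + Δ′` of [4] (3.10), both
# ZERO on the flat pure-gauge model (`curl_grad_eq_zero`); the model is SILENT on (1.39) — HONEST SCOPE (v)–(vii)

CITATION HEADER (lean-in-tree rule 2026-08-18).  Model computation bearing on Theorem 8, p. 101 [PDF 27], of
T. Bałaban, *Spaces of regular gauge field configurations on a lattice and gauge fixing conditions*, Comm. Math.
Phys. **99**, 75–102 (1985) [Balaban1985RegularSpaces] (cell paper B8 of the audit cell `pub-balaban`;
`paper:balaban1985-cmp99-regular-spaces-gauge-fixing`, journal page = PDF page + 74), with the bounds (1.36) of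
p. 82 [PDF 8].  Renders re-read AS IMAGES by the filing unit on 2026-08-19:
`…1985-cmp99-regular-spaces-gauge-fixing-p008-x2.png`, `-p009-x2.png`, `-p027-x2.png`; for v1.1 in addition
`-p007-x2.png` ((1.29)), `-p009-x2.png` ((1.39)), `-p012-x2.png` (p. 86: (1.55), `G(U₀)`, (1.59); v1.2),
`-p027-x2.png` (Theorem 8) and, for the NORM AND OPERATOR DEFINITIONS ONLY (operators: p. 392, render
`…/1985-cmp99-background-propagators-p004-x2.png`, v1.2), the
companion paper T. Bałaban, *Propagators for lattice gauge theories in a background field*, Comm. Math. Phys. **99**,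
389–434 (1985) [Balaban1985BackgroundPropagators] (cell paper B9, journal page = PDF page + 388), renders
`…1985-cmp99-background-propagators-p006-x2.png` (p. 394, (3.20)–(3.25)) and `-p009-x2.png` (p. 397, (3.39)–(3.41)).  The paper is a manuscript
UNDER ADJUDICATION by the cell; NOTHING of it is asserted or used here: every declaration below is an elementary,
kernel-proved statement about explicit functions on the lattice `ℤ²` (tag [folklore]); the printed text is quoted
only to locate what the computation bears on.

PRINTED (B8 p. 82, (1.36)): "U₁ = e^{iηA}, |A| < B₁(α₀ + α₁)(L^jη)^{−1}, |∇^η_{U₀}A| < B₁(α₀ + α₁)(L^jη)^{−2},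
‖A‖_{1,β} < B₂(β₀)(α₀ + α₁)(L^jη)^{−2−β}, β ≦ β₀ < 1, on Ω_j, j = 0, 1, …, k, (1.36)".
PRINTED (B8 p. 83): "Of course we want to prove that the constants B₁, B₂(β₀) in (1.36), (1.39) are absolute
constants depending on d and L only, B₂(β₀) on β₀ also."
PRINTED (B8 p. 83, (1.39)): "Such information is unavailable for the second order derivatives, but we have the
following bounds for the second order operators acting on A: |D^{η*}_{U₀}D^η_{U₀}A|, |Δ^η_{U₀}A| < B₁(α₀ + α₁)(L^jη)^{−3}
on Ω_j, j = 0, 1, …, k. (1.39)".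
PRINTED (B9 = [4] of B8, p. 392 — the operators on BOND functions; quoted for the v1.2 ERRATUM): "The operator adjoint
to derivative D, acting on functions defined at bonds, is the operator acting on functions F defined at plaquetts by
the formula (D*F)(x, x + ηe_μ) = (D*F)_μ(x) = Σ_{ν} (D*_ν F_{νμ})(x), (3.9)" and "The quadratic terms in the expansion
(3.7) define the basic operator generalizing the operator ∂*∂ in the Abelian case. We denote it by Δ^η(U), or simply
by Δ. For U with values in the unitary group U(N) it is a hermitian operator given by the quadratic form ⟨A, ΔA⟩ =
⟨A, D*DA⟩ + ⟨A, Δ′A⟩, ⟨A, Δ′A⟩ = Σ_{p⊂T_η} η^d tr((D¹_U A)(p))² η^{−2}(Re U(∂p) − 1) + tr Σ_{b₁,b₂⊂∂(p), b₁≺b₂}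
i[A′(b₁), A′(b₂)] η^{−2} Im U(∂p). (3.10)".
PRINTED (B8 p. 86 — how B8 itself uses these operators; quoted for the v1.2 ERRATUM): "This implies that
D^{η*}_{U₀}D^η_{U₀}A = J, |J| ≦ (2α₀ + 36dα₂(L^jη)²|∇^η_{U₀}A| + 50dα₂³ + 10dα₀α₂)(L^jη)^{−3}, (1.55)" (obtained from
the plaquette expansion (1.43) of (U₁U₀)(∂p) − 1), "G(U₀) = (D^{η*}_{U₀}D^η_{U₀} + D^η_{U₀}R(U₀)D^{η*}_{U₀} +
Σ_j Q*_jΛ_j(L^jη)^{−2}Q_j)^{−1}" and "Theorem 3.3 of [4] implies the bounds: |A|₍₋₁₎, |∇^η_{U₀}A|₍₋₂₎,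
|D^{η*}_{U₀}D^η_{U₀}A|₍₋₃₎, |Δ^η_{U₀}A|₍₋₃₎ ≦ B₀(|J|₍₋₃₎ + |B₁|) (1.59)".
PRINTED (B8 p. 81, (1.29)): "(R₀u^j)(y) = 1 for y ∈ Λ_j, j = 0, 1, …, k. (1.29)" [the restriction on the gauge
transformations u = e^{iλ}; its linear part is λ ∈ N(Q′)].
PRINTED (B9 p. 394): "where R = R(U) is an orthogonal projection in the Hilbert space L²(Ω₀, g) onto the subspace
R = Δ^η_U N(Q′), N(Q′) = {λ : Q′λ = 0}. (3.21)"; "Δ^η_U = D^{η*}_U D^η_U = Σ_{μ=1}^{d} D^{η*}_{U,μ} D^η_{U,μ}. (3.23)".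
PRINTED (B9 p. 397, the norms used in (1.36), (1.39) and in |f|₍₋₂₎): "|A| = max_μ sup_x |A_μ(x)|, |∇A| = max_{μ,ν}
sup_x |(D_μA_ν)(x)|, (3.39)"; "‖A‖_{1,α} = ‖∇A‖_α = max_{μ,ν} sup_{x,x′:|x−x′|≦1} |x′ − x|^{−α} |R(U(Γ_{x,x′}))(D_μA_ν)(x′)
− (D_μA_ν)(x)|, where Γ_{x,x′} is a shortest contour connecting points x and x′. It is understood that the η-scale
is used in the above definitions." (3.40); "|A|₍α₎ = sup_{0≦j≦k} sup_{b∈Ω_j∖Ω_{j+1}} (L^jη)^{−α}|A(b)|. (3.41) Thus the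
norm |A|₍α₎ can be defined as the smallest number C such, that |A(b)| ≦ C(L^jη)^α for b ∈ Ω_j∖Ω_{j+1}, j = 0, 1,
…, k. For α negative we can take Ω_j instead of Ω_j∖Ω_{j+1} above."
PRINTED (B8 p. 101): "general condition of the form R(U₀)D^{η*}_{U₀}A = f, (1.146) where f is a function from the
space R(U₀), i.e. a Lie algebra valued function defined on Ω₀ and satisfying R(U₀)f = f. Of course we have to
assume that f is in a sufficiently small neighborhood of 0, for example it is enough to assume that |f|₍₋₂₎ <
γ(α₀ + α₁) with a positive, not too big, constant γ, e.g. γ = 1. Inspecting the proofs of the theorems and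
propositions we can see easily that they work in this more general situation almost without any changes, only some
constants change their numerical values. Thus we have the following generalization of Theorem 2.
**Theorem 8.** There exist constants B₁, B₂(β₀), c₁ such that for arbitrary U₀, U′U₀ satisfying (1.33)–(1.35)
with α₀ + α₁ ≦ c₁, and for an arbitrary function f from the space R(U₀) satisfying the bound |f|₍₋₂₎ < γ(α₀ + α₁),
there exists exactly one gauge transformation u satisfying (1.29) and such, that the conditions (1.36), (1.37),
(1.39), and (1.146) hold for the configuration U₁ = U′^{u⁻¹}. The constants B₁, B₂(β₀) are as in Theorems 2, 4,
the constant c₁ depends on d, L and γ."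

WHAT THE TREE ALREADY HAS.  `B8.Thm8Printed` (reader r1: the printed statement, typed) and `B8.Thm8Inspected`
(sub-cell B08: the part of Theorem 8 the printed "inspection" delivers), whose docstring records the cell's objection
GAPS G-B8-13: for a source `f` controlled only in the sup-type norm `|f|₍₋₂₎` the `|∇^η_{U₀}A|`- and `‖A‖_{1,β}`-
clauses of (1.36) are not delivered with constants independent of the number of scales `k`, the model being
`U₀ = 1`, `f = Δλ₀`, where `∇A ⊇ Hess Δ⁻¹f` is an order-zero (Calderón–Zygmund-type) multiplier acting on a sup-norm
datum.  Until now the quantitative evidence for the divergence was ONE floating-point computation (cell numerics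
N-B8-4, kit job j038525: `sup|∂₁∂₂Δ_D⁻¹f| / sup|f| = 1.18, 1.60, 2.03, 2.47, 2.91, 3.35` on Dirichlet boxes of
`N = 16, …, 512` points per side).

WHAT THIS FILE ADDS (kernel-checked; new sibling module, nothing above is edited; imports Mathlib only).  An EXPLICIT
family of finitely supported lattice functions exhibiting the logarithmic divergence, with an exact constant:
§1 the five-point Laplacian `lap` and the forward mixed difference `mixed` = `∂₁∂₂` on `ℤ²` (unit spacing);
§2 the radial profile `g K r = (H_K − H_r) − (K − r)/K` for `r ≤ K`, `0` beyond (`H_n` = `harmonic n`), i.e.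
   `g K r = Σ_{s=r+1}^{K} (1/s − 1/K)`: `g_step`, `g_of_le`, `g_two : g K 2 = H_K − 5/2 + 2/K`;
§3 the witness **`v K (x₁, x₂) = x₁ x₂ · g K (|x₁| + |x₂|)`** — the lattice-harmonic quadratic `x₁x₂` times a
   logarithmic profile of the ℓ¹-radius, tapered so that `g K (K) = 0` and the radial slope vanishes at `r = K` —
   with: `abs_lap_v_le_two : ∀ K x, |Δ v_K (x)| ≤ 2` (closed form in the open quadrant,
   `lap_v_quadrant_closed : Δv_K(a+1,b+1) = 2(a+1)(b+1)/(r(r+1)) − (2r+1)/(r+1) + 2r/K`, `r = a+b+2 < K`; zero on the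
   axes by oddness and beyond radius `K − 2`); `mixed_v_zero_eq : (∂₁∂₂v_K)(0) = H_K − 5/2 + 2/K` (`2 ≤ K`);
   `v_eq_zero_of_le : v_K = 0` where `|x₁| + |x₂| ≥ K − 1`; oddness `v_neg_fst` and the vanishing of the sums of `v_K`
   over every reflection-symmetric finite set (`sum_v_reflect`, `sum_v_box`: block means vanish, the flat-model
   analogue of the constraint `λ₀ ∈ N(Q′)`);
§4 the discrete maximum principle and UNIQUENESS for the lattice Dirichlet problem on an arbitrary finite set
   (`eq_zero_of_lap_eq_zero`, `dirichlet_unique`), so that `v_K` IS the Dirichlet solution `Δ_D⁻¹f` of its own datum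
   `f = Δv_K` on any finite `S ⊇ supp v_K` (`mixed_dirichlet_solution`) — the object of the numerics N-B8-4;
§5 the real-variable consequences: `log_le_mixed_v_zero : log(K+1) − 5/2 ≤ (∂₁∂₂v_K)(0)` (Mathlib
   `log_add_one_le_harmonic`), **`no_uniform_sup_hessian_bound : ∀ C, ∃ K, ∃ w` finitely supported with `|Δw| ≤ 2`
   everywhere and `(∂₁∂₂w)(0) > C`**, the negated uniform estimate `not_exists_uniform_constant` (no `C` with
   `sup|∂₁∂₂w| ≤ C · sup|Δw|` over finitely supported `w`), and the count in scales `scales_lower_bound :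
   k·log L − 5/2 ≤ (∂₁∂₂ v_{L^k})(0)` — with `|Δ v_{L^k}| ≤ 2` the ratio grows at least linearly in the number `k` of
   `L`-adic scales, rate `≥ (log L)/2` per scale (the float table's empirical rate `(2/π)·log 2` per doubling is NOT
   certified here and is not needed);
§6 the `d = 4` reading: for functions constant along `x₃, x₄` the `ℤ⁴` Laplacian and `∂₁∂₂` reduce to the `ℤ²` ones
   (`lap4_lift`, `mixed4_lift`, `no_uniform_sup_hessian_bound4`; cylindrical support).
Sanity values (`example`s at the end, kernel-evaluated): `(∂₁∂₂v₄)(0) = 1/12`, `Δv₄(1,1) = −1/3`.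
§7 (v1.1, APPENDED after the v1 sanity values; every v1 declaration above it is byte-identical) — the Hölder clause
   `‖A‖_{1,β} < B₂(β₀)(α₀ + α₁)(L^jη)^{−2−β}` of (1.36), WHICH v1 DID NOT MODEL (v1.1 presented §7 as modelling ALSO
   «the `|Δ^η_{U₀}A|`-clause of (1.39)» — RETRACTED, HONEST SCOPE (vii): the model is silent on (1.39)), in the FLAT
   PURE-GAUGE MODEL `U₀ = U′ = 1`, `u = e^{iλ}`, `λ ∈ N(Q′)` ((1.29) linearised), abelian:
   then `U₁ = U′^{u⁻¹} = e^{iηA}` with `A = ∇^ηλ`, `D^{η*}_{U₀}A = Δ^ηλ ∈ Δ^η N(Q′) = R(U₀)` ((3.21)), so (1.146)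
   reads `f = Δ^ηλ` and the printed hypothesis `|f|₍₋₂₎ < γ(α₀ + α₁)` reads `|Δ^ηλ| < γ(α₀ + α₁)(L^jη)^{−2}` on `Ω_j`
   ((3.41), α = −2).  In lattice units (`λ̃(n) = λ(ηn)`, `N := L^jη/η = L^j` lattice points per block scale on `Ω_j`;
   `∇^η = η⁻¹∂`, `Δ^η = ∓η⁻²·lap`): the hypothesis is `sup|lap λ̃| < γ(α₀ + α₁)N^{−2}`; the Hölder clause, already
   restricted to ONE Hessian component and to `η`-NEAREST-NEIGHBOUR pairs (admissible in (3.40): "the η-scale is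
   used", `|x − x′| = η ≦ 1`), demands `|∂₁(∂₁∂₂λ̃)| ≦ B₂(β₀)(α₀ + α₁)·η^{2+β}(L^jη)^{−2−β} = (B₂(β₀)/γ)·N^{−β}·
   [γ(α₀ + α₁)N^{−2}]`, i.e. the estimate shape `(jump of Hess w) ≤ C·N^{−β}·sup|lap w|`; and the GRADIENT
   HYPOTHESIS ON THE SOURCE which GAPS G-B8-13 ADDS, `|D^η_{U₀}f|₍₋₃₎ < γ′(α₀ + α₁)`, i.e. `η^{−3}|∂_ν lap λ̃| <
   γ′(α₀ + α₁)(L^jη)^{−3}`, would follow from the printed `|f|₍₋₂₎`-hypothesis iff the shape `|∂ lap w| ≤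
   C·N^{−1}·sup|lap w|` held (`C = γ′/γ`) [v1.1 wrote here «the `Δ`-clause of (1.39) demands …» — RETRACTED, (vii)].
   KERNEL CONTENT: `d1`, `d2` (forward differences), `mixed_eq_d1_d2` (`∂₁∂₂ = ∂₁∘∂₂ = ∂₂∘∂₁`); the flat-lattice
   commutation **`d1_lap`, `d2_lap` : `∂_ν Δ = Δ ∂_ν`** — so the COMPONENTWISE Laplacian of the gradient field is
   the gradient of the source, `Δ^η(∇^η_νλ) = ∇^η_ν Δ^ηλ = ∇^η_ν f` identically [v1.1 continued «in the model the
   `Δ`-clause of (1.39) IS the bound |∇^η f| < …, i.e. the cell's added hypothesis is NECESSARY» — RETRACTED, (vii):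
   the componentwise Laplacian is NOT the `Δ^η_{U₀}` of (1.39), which is the Wilson Hessian `D*D + Δ′` of [4] (3.10)
   and vanishes on the model, §8 `curl_grad_eq_zero`]; the trace identity
   **`lap_eq_trace` : `Δw(x) = (∂₁∂₁w)(x − e₁) + (∂₂∂₂w)(x − e₂)`** with `abs_lap_sub_lap_le` (jumps of the source `Δw` are
   dominated by the jumps of the diagonal Hessian components) — so the Hölder clause on `∇A ⊇ Hess λ` forces the SAME
   `η`-scale `β`-Hölder bound, times `d`, on `f` itself: the alternative repair of G-B8-13 (a scaled Hölder bound on `f`)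
   is likewise necessary; the witness values **`mixed_v_jump` : `(∂₁∂₂v_K)(1,0) − (∂₁∂₂v_K)(0,0) = −2/3 + 2/K`** and
   **`lap_v_jump` : `Δv_K(1,1) − Δv_K(0,1) = −4/3 + 4/K`** (`3 ≤ K`; fixed nonzero numbers, `≥ 1/6` resp. `≥ 1/3` in
   modulus for `K ≥ 4`, while `sup|Δv_K| ≤ 2`); the admissibility lemma `sum_v_eq_zero_of_box_subset` (zero sum over
   EVERY finite set containing the support box — so all block means of the witness vanish as soon as its support sits
   inside one averaging block: the flat `λ ∈ N(Q′)`); and the negated uniform estimates with the FIXED bump `v₄`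
   (support radius 2, fits every region `N ≥ 4`): **`not_exists_uniform_holder_constant`** (for every `β > 0` NO `C`
   with `|∂₁(∂₁∂₂w)| ≤ C·N^{−β}·sup|Δw|` for all `N ≥ 4` and all `w` supported within radius `N − 2`; `Real.rpow`) and
   **`not_exists_uniform_grad_lap_constant`** (NO `C` with `|∂₁Δw| ≤ (C/N)·sup|Δw|`: the gradient hypothesis on
   the source is a genuinely STRONGER norm than the printed one, by the factor `N` at block scale `N` — NOT a (1.39)
   statement, (vii)), plus the `d = 4` lift `holder_and_139_witness4` (the `139` in the name is the retracted v1.1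
   label, kept under append-only naming).  RATES (dictionary reading, from the fixed witness): the constant the Hölder
   clause would need at region scale `N` is `≥ N^β/12`; bounding `|∇^η f|₍₋₃₎` by `|f|₍₋₂₎` would need `≥ N/6` —
   power laws in `N = L^j`, against the logarithm `≥ (log N − 5/2)/2` of the sup clause (§5) [v1.1's «of the three
   clauses not delivered under |f|₍₋₂₎ alone, (1.39) is the most … sensitive» is RETRACTED: the clauses of Theorem 8
   not delivered under `|f|₍₋₂₎` alone are the TWO of (1.36), ∇ and Hölder — GAPS G-B8-13 as filed by gen 1].
   Sanity values (kernel):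
   `(∂₁∂₂v₄)(1,0) − (∂₁∂₂v₄)(0,0) = −1/6`, `Δv₄(1,1) − Δv₄(0,1) = −1/3`, `Δv₆(1,1) − Δv₆(0,1) = −2/3`.

SECOND ENGINE (cell AUTOPSY RULES: two independent engines).  Exact-rational enumeration, independent of Lean:
`pub-balaban/b2b-balaban-b08/g13/witness_check.py` (sha256[:16] f4ef9ea399f92974) → `witness_check.out`
(2fb8770c91231377): for `K ∈ {3,4,5,6,8,10,16,32,64,100}` it confirms `(∂₁∂₂v_K)(0) = H_K − 5/2 + 2/K` exactly,
support radius `K − 2`, and `sup_x|Δv_K(x)| = 0, 1/3, 8/15, 2/3, 5/6, 14/15, 13/12, 301/240, 13/9, 17/11` (all `< 2`;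
the kernel bound `2` is not sharp: the supremum tends to `2` from below as `K → ∞` — DOCFIX D1 of the cross-read
GAPS C-pv14-49 (v1 named the wrong locus "`a + 1 = K − 2`, `b = 0`", where in fact `Δv_K(K−2, ±1) = (K−3)/((K−1)K) → 0`):
the extremal values sit on the rows `x₂ = ±1` (and, by the symmetry `x₁ ↔ x₂`, the columns `x₁ = ±1`) at `|x₁| ≍ √K`,
where the closed form with `b = 0`, `Δv_K(a+1, 1) = 2(a+1)/((a+2)(a+3)) − (2a+5)/(a+3) + 2(a+2)/K`, is minimal; exact
`argmax |Δv_K|` in the closed quadrant `= (4,1) ~ (1,4)`, `(7,1)`, `(9,1)`, `(22,1)` with values `−301/240`, `−13/9`,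
`−17/11`, `−12169/6900 = −1.7636…` for `K = 32, 64, 100, 400` (two engines: the cross-reader's, and
`pub-balaban/code/b2b-balaban-b08/g14/witness_check_v11.py --locus`, output `witness_check_v11_locus.out`)).
v1.1 SECOND ENGINE for §7: `pub-balaban/code/b2b-balaban-b08/g14/witness_check_v11.py` (exact rationals) confirms
`(∂₁∂₂v_K)(1,0) − (∂₁∂₂v_K)(0,0) = −2/3 + 2/K` and `Δv_K(1,1) − Δv_K(0,1) = −4/3 + 4/K` for `K ∈ {3, 4, 5, 6, 8, 16, 32,
64}` (`K = 3`: `v₃ ≡ 0`, both sides `0`), and tabulates `sup|Δv_K|`, the maximal nearest-neighbour Hessian jump and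
`max|∇Δv_K|` (`K = 4`: `1/3`, `1/4`, `5/12`; the ratios jump/sup and grad/sup stay `O(1)`: `0.94`, `1.00` at `K = 64`)
— output `witness_check_v11.out`; file hashes in `pub-balaban/code/b2b-balaban-b08/README.md`.

HONEST SCOPE / NOT TYPED.  (i) MODEL LEVEL ONLY: flat background `U₀ = 1`, scalar (abelian, one Lie-algebra
component), one region, unit lattice; none of B8's operators `G(U₀)`, `R(U₀)`, `Q′`, `D^η_{U₀}` or norms `|·|₍₋₂₎`,
`‖·‖_{1,β}` is typed here, and no statement of the paper is refuted in the kernel: what is certified is the lattice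
fact that an estimate of the shape `sup|∇∇Δ⁻¹f| ≤ B · sup|f|` — which the printed hypothesis `|f|₍₋₂₎ < γ(α₀ + α₁)`
together with the `|∇^η_{U₀}A|`-clause of (1.36) "with constants as in Theorems 2, 4" would instantiate in this
model (cell reading G-B8-13: `A ∋ ∇Δ⁻¹f`-component, `∇A ⊇ Hess Δ⁻¹f`) — admits NO constant `B` uniform in the size of
the region measured in lattice units, i.e. in the number of scales.  The dictionary model ↔ (1.36)/(1.146) is the
cell's (GAPS G-B8-13, DIVERGENCE D-b08-g13.1), not the paper's.  (ii) The verdict TEXT of G-B8-13 (located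
objection; the `|A|`-clause, (1.37), (1.146) and uniqueness survive; repair = an added gradient/Hölder hypothesis on
`f`) is unchanged; only its evidence class changes (single-engine floats → kernel witness + exact engine).
(iii) Block parity: `sum_v_box` gives mean zero over boxes symmetric under `x₁ ↦ −x₁` (odd side, centred at a lattice
point); even-side blocks would use the half-integer-shifted witness, not typed; v1.1 adds the cleaner sufficient
condition `sum_v_eq_zero_of_box_subset` (support inside one block ⟹ all block means vanish), which covers the fixed
bump `v₄` of §7 in every block of side `≥ 5` lattice points.  (iv) [v1: "the Hölder clause is not modelled
separately"] — SUPERSEDED by §7 (v1.1): the Hölder clause of (1.36) is modelled [v1.1: «and the `Δ`-clause of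
(1.39)» — RETRACTED, (vii)], in the flat PURE-GAUGE model `U₀ = U′ = 1` (trivial data, the source `f` the only datum), again at MODEL LEVEL ONLY and again
only in the weak form "already one component / nearest-neighbour pairs / a fixed bump violate the estimate shape";
the dictionary (η-neighbour pairs admissible in (3.40); `N = L^j`; `C = B₂(β₀)/γ` resp. `B₁/γ`) is the cell's
(DIVERGENCE D-b08-g14.1, items (e)/(f) corrected by D-b08-g14.2).  (v) [v1.2; the v1.1 text of (v) — «either way the
objection of §7 is carried by the `Δ^η_{U₀}A`-member» — is SUPERSEDED] THE OPERATORS OF (1.39) ON BOND FUNCTIONS: by [4]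
p. 392 (3.8)–(3.10), PRINTED above, `D^η_U` maps bond functions to PLAQUETTE functions (the covariant exterior
derivative; its adjoint (3.9) maps plaquette functions back to bond functions — whereas the `D^{η*}_{U₀}` of
(1.38)/(1.146) is the bond → site adjoint (3.8)), and `Δ^η(U) := D*D + Δ′` is the Hessian of the Wilson action,
«generalizing the operator ∂*∂ in the Abelian case», `Δ′` the curvature form of (3.10) (zero at `U = 1`).  B8 uses
exactly these (p. 86, PRINTED above): (1.55) obtains `D^{η*}_{U₀}D^η_{U₀}A = J` from the plaquette expansion (1.43), the
printed `G(U₀)` is `(D*D + DRD* + ΣQ*ΛQ)⁻¹`, and the members of (1.39)/(1.62) are the Theorem-3.3 entries for `G(U₀)`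
((1.59)).  In the flat pure-gauge model `A = ∇^ηλ` the plaquette field VANISHES, `(D^ηA)(p₁₂) = ∂₁∂₂λ − ∂₂∂₁λ = 0`
(kernel: §8 `curl_grad_eq_zero`, from `mixed_eq_d1_d2`/`mixed_eq_d2_d1`), hence `D^{η*}D^ηA = 0` and `Δ^η_{U₀}A =
(D*D + Δ′)A = 0`: BOTH members of (1.39) hold trivially — the model of this file is SILENT on (1.39).  (vi) [v1.1:
«RECORDS AMENDMENT: the gen-1 aside of GAPS G-B8-13 ‹(1.39) without the added hypothesis is plausible by a reorganised
argument (…) which the paper does not print — not certified› is WITHDRAWN — by `d1_lap` …»] — RETRACTED by (vii): the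
aside is REINSTATED verbatim (GAPS C-B8-36 withdraws the AMENDMENT of C-B8-35); the verdict class of G-B8-13, its
surviving clauses (`|A|`-clause, (1.37), (1.146), uniqueness — `B8.Thm8Inspected`) and the consumer finding (B11 uses
none of the (1.36) clauses at issue: GAPS G-B11-E3a) were and are UNCHANGED.  (vii) ERRATUM v1.2 (gen 14, the session
of v1.1; self-found while settling DIVERGENCE D-b08-g14.1 (f)): v1.1 read `Δ^η_{U₀}A` in (1.39) as the COMPONENTWISE
covariant Laplacian of the bond function `A` (the scalar operator (3.23) applied to each `A_ν`); under that reading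
`d1_lap` gives `(Δ^ηA)_ν = ∇^η_ν f`, and §7 was presented as a witness against «the `Δ`-clause of (1.39)».  That
reading has no support in the sources ((v)).  On the flat lattice the componentwise Laplacian of a 1-form is the Hodge
sum `∂*∂ + ∂∂*` (kernel, for the gradient field: `lap_eq_div_grad` + `curl_grad_eq_zero`, §8); (1.39) controls the
`∂*∂`-part, zero in the model, and the divergent quantity of §7 is the `∂∂*`-part `∂(∂*A) = ∇f` — second-derivative
information which B8 p. 83 explicitly does NOT claim («Such information is unavailable for the second order
derivatives»).  CONSEQUENCES: every KERNEL STATEMENT of v1/v1.1 stands (lattice identities about explicit functions,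
never about B8's operators); RETRACTED is the B8-labelling of `d1_lap`, `lap_v_jump`, `d1_lap_v`, `abs_lap_v_jump_ge`,
`lap_v4_jump`, `not_exists_uniform_grad_lap_constant` and the 4th conjunct of `holder_and_139_witness4` as «(1.39)-clause»
material — they quantify instead how far the printed hypothesis `|f|₍₋₂₎` is from the gradient hypothesis
`|D^η_{U₀}f|₍₋₃₎` that G-B8-13 adds (ratio `≥ N/6` at block scale `N`: a genuinely stronger norm, not a reformulation);
the (1.36) material is UNAFFECTED (§§1–6 sup clause; §7 Hölder clause: `not_exists_uniform_holder_constant`,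
`abs_mixed_v_jump_ge`, `mixed_v_jump`, `lap_eq_trace`, `abs_lap_sub_lap_le`) — `∇^η_{U₀}A` in (1.36) is the full
covariant gradient `(D_μA_ν)_{μ,ν}` of [4] (3.39), PRINTED above, which contains the mixed second differences of `λ`.
Whether (1.39) holds for Theorem 8 under `|f|₍₋₂₎` alone is again exactly as OPEN as gen 1 left it (the printed route
(1.55) → (1.59) bounds `J` through `|∇^η_{U₀}A|₍₋₂₎`, which is the undelivered ∇-clause; a direct route is not printed).
Decl names are kept (append-only discipline).  Records: GAPS C-B8-36 (erratum), DIVERGENCE D-b08-g14.2.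
Census rows: GAPS C-B8-34 (v1), C-B8-35 (v1.1), C-B8-36 (v1.2 erratum: C-B8-35's AMENDMENT withdrawn), G-B8-13 (gen 1;
its aside on (1.39) REINSTATED); DIVERGENCE D-b08-g13.1, D-b08-g14.1, D-b08-g14.2.
-/

namespace Literature.MathematicalPhysics.QuantumFieldTheory.Balaban1983to89.B8HessianSupWitness

open Finset

/-! ### §1 Lattice operators on `ℤ²` -/

/-- [folklore] Sites of the unit lattice `ℤ²`. -/
abbrev Site : Type := ℤ × ℤ

/-- [folklore] The five-point lattice Laplacian (unit spacing):
`(Δw)(x) = w(x+e₁) + w(x−e₁) + w(x+e₂) + w(x−e₂) − 4w(x)`. -/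
def lap (w : Site → ℚ) (x : Site) : ℚ :=
  w (x.1 + 1, x.2) + w (x.1 - 1, x.2) + w (x.1, x.2 + 1) + w (x.1, x.2 - 1) - 4 * w x

/-- [folklore] The forward mixed second difference `(∂₁∂₂w)(x) = w(x+e₁+e₂) − w(x+e₁) − w(x+e₂) + w(x)`. -/
def mixed (w : Site → ℚ) (x : Site) : ℚ :=
  w (x.1 + 1, x.2 + 1) - w (x.1 + 1, x.2) - w (x.1, x.2 + 1) + w x

/-- [folklore] `Δ` is additive: Laplacian of a difference. -/
theorem lap_sub (w₁ w₂ : Site → ℚ) (x : Site) :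
    lap (fun y => w₁ y - w₂ y) x = lap w₁ x - lap w₂ x := by
  simp only [lap]; ring

/-- [folklore] Laplacian of the negative. -/
theorem lap_neg (w : Site → ℚ) (x : Site) : lap (fun y => -w y) x = -lap w x := by
  simp only [lap]; ring

/-! ### §2 The radial profile `g K r = Σ_{s=r+1}^{K} (1/s − 1/K)` -/

/-- [folklore] The tapered logarithmic profile: `g K r = (H_K − H_r) − (K − r)/K` for `r ≤ K` and `0` for `r ≥ K`
(`H_n = harmonic n`); equivalently `Σ_{s=r+1}^{K} (1/s − 1/K)`.  Both `g K K = 0` and the last step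
`g K (K−1) − g K K = 0` vanish (the taper), which is what keeps `Δ(x₁x₂·g)` bounded at the edge of the support. -/
def g (K r : ℕ) : ℚ :=
  if r ≤ K then harmonic K - harmonic r - ((K : ℚ) - r) / K else 0

/-- [folklore] `g` vanishes from `r = K` on. -/
theorem g_of_le {K r : ℕ} (h : K ≤ r) : g K r = 0 := by
  unfold g
  split_ifs with h'
  · have : r = K := le_antisymm h' h
    subst this
    simp
  · rfl

/-- [folklore] The step of the profile: `g K r − g K (r+1) = 1/(r+1) − 1/K` for `r + 1 ≤ K`. -/
theorem g_step {K r s : ℕ} (hs : s = r + 1) (h : s ≤ K) :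
    g K r = g K s + (1 / (s : ℚ) - 1 / K) := by
  subst hs
  have hK : (K : ℚ) ≠ 0 := by exact_mod_cast (show K ≠ 0 by omega)
  have h1 : r ≤ K := by omega
  simp only [g, if_pos h1, if_pos h, harmonic_succ]
  push_cast
  field_simp
  ring

/-- [folklore] The value feeding `(∂₁∂₂ v_K)(0)`: `g K 2 = H_K − 5/2 + 2/K` (`2 ≤ K`). -/
theorem g_two {K : ℕ} (hK : 2 ≤ K) : g K 2 = harmonic K - 5 / 2 + 2 / K := by
  have hK' : (K : ℚ) ≠ 0 := by exact_mod_cast (show K ≠ 0 by omega)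
  have h2 : harmonic 2 = 3 / 2 := by
    simp only [harmonic, Finset.sum_range_succ, Finset.sum_range_zero]
    norm_num
  simp only [g, if_pos hK, h2]
  field_simp
  ring

/-! ### §3 The witness `v K (x₁, x₂) = x₁ x₂ · g K (|x₁| + |x₂|)` -/

/-- [folklore] **The witness**: the lattice-harmonic quadratic `x₁x₂` times the logarithmic profile of the
ℓ¹-radius.  Odd under each reflection `x₁ ↦ −x₁`, `x₂ ↦ −x₂`, symmetric under `x₁ ↔ x₂`, supported in the ℓ¹-ball
of radius `K − 2`. -/
def v (K : ℕ) (x : Site) : ℚ :=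
  (x.1 : ℚ) * x.2 * g K (x.1.natAbs + x.2.natAbs)

/-- [folklore] Value of the witness at a site with natural-number coordinates. -/
theorem v_natCast (K a b : ℕ) : v K ((a : ℤ), (b : ℤ)) = (a : ℚ) * b * g K (a + b) := by
  simp [v, Int.natAbs_natCast]

/-- [folklore] `v_natCast` with the coordinates and the radius supplied as equations (rewriting helper). -/
theorem v_at (K : ℕ) {m n : ℤ} {a b r : ℕ} (hm : m = a) (hn : n = b) (hr : a + b = r) :
    v K (m, n) = (a : ℚ) * b * g K r := by
  subst hm; subst hn; subst hr
  exact v_natCast K a b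

/-- [folklore] Oddness in the first coordinate. -/
theorem v_neg_fst (K : ℕ) (m n : ℤ) : v K (-m, n) = -v K (m, n) := by
  simp only [v, Int.natAbs_neg, Int.cast_neg]
  ring

/-- [folklore] Oddness in the second coordinate. -/
theorem v_neg_snd (K : ℕ) (m n : ℤ) : v K (m, -n) = -v K (m, n) := by
  simp only [v, Int.natAbs_neg, Int.cast_neg]
  ring

/-- [folklore] The witness vanishes on the axis `x₁ = 0`. -/
theorem v_fst_zero (K : ℕ) (n : ℤ) : v K (0, n) = 0 := by
  simp [v]

/-- [folklore] The witness vanishes on the axis `x₂ = 0`. -/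
theorem v_snd_zero (K : ℕ) (m : ℤ) : v K (m, 0) = 0 := by
  simp [v]

/-- [folklore] SUPPORT: `v_K(x) = 0` as soon as `|x₁| + |x₂| ≥ K − 1` (the profile vanishes at radius `K − 1` and
beyond), so `v_K` is supported in the ℓ¹-ball of radius `K − 2` — inside one box of side `≥ 2K − 3`. -/
theorem v_eq_zero_of_le (K : ℕ) (x : Site) (h : K ≤ x.1.natAbs + x.2.natAbs + 1) : v K x = 0 := by
  unfold v
  have hg : g K (x.1.natAbs + x.2.natAbs) = 0 := by
    rcases eq_or_lt_of_le h with h' | h'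
    · rcases Nat.eq_zero_or_pos K with hK | hK
      · exact g_of_le (by omega)
      · rw [g_step (K := K) (r := x.1.natAbs + x.2.natAbs) (s := K) (by omega) le_rfl, g_of_le le_rfl]
        ring
    · exact g_of_le (by omega)
  rw [hg, mul_zero]

/-- [folklore] `Δv_K` is odd in the first coordinate. -/
theorem lap_v_neg_fst (K : ℕ) (m n : ℤ) : lap (v K) (-m, n) = -lap (v K) (m, n) := by
  have h1 : v K (-m + 1, n) = -v K (m - 1, n) := by
    rw [show -m + 1 = -(m - 1) by ring, v_neg_fst]
  have h2 : v K (-m - 1, n) = -v K (m + 1, n) := by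
    rw [show -m - 1 = -(m + 1) by ring, v_neg_fst]
  have h3 : v K (-m, n + 1) = -v K (m, n + 1) := v_neg_fst K m (n + 1)
  have h4 : v K (-m, n - 1) = -v K (m, n - 1) := v_neg_fst K m (n - 1)
  have h5 : v K (-m, n) = -v K (m, n) := v_neg_fst K m n
  simp only [lap]
  rw [h1, h2, h3, h4, h5]
  ring

/-- [folklore] `Δv_K` is odd in the second coordinate. -/
theorem lap_v_neg_snd (K : ℕ) (m n : ℤ) : lap (v K) (m, -n) = -lap (v K) (m, n) := by
  have h1 : v K (m, -n + 1) = -v K (m, n - 1) := by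
    rw [show -n + 1 = -(n - 1) by ring, v_neg_snd]
  have h2 : v K (m, -n - 1) = -v K (m, n + 1) := by
    rw [show -n - 1 = -(n + 1) by ring, v_neg_snd]
  have h3 : v K (m + 1, -n) = -v K (m + 1, n) := v_neg_snd K (m + 1) n
  have h4 : v K (m - 1, -n) = -v K (m - 1, n) := v_neg_snd K (m - 1) n
  have h5 : v K (m, -n) = -v K (m, n) := v_neg_snd K m n
  simp only [lap]
  rw [h1, h2, h3, h4, h5]
  ring

/-- [folklore] `Δv_K = 0` on the axis `x₁ = 0` (oddness: the two horizontal neighbours cancel). -/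
theorem lap_v_fst_zero (K : ℕ) (n : ℤ) : lap (v K) (0, n) = 0 := by
  have h1 : v K (0 - 1, n) = -v K (1, n) := by
    rw [show (0 : ℤ) - 1 = -1 by ring, v_neg_fst]
  have h2 : v K (0 + 1, n) = v K (1, n) := by rw [zero_add]
  simp only [lap]
  rw [h1, h2, v_fst_zero, v_fst_zero, v_fst_zero]
  ring

/-- [folklore] `Δv_K = 0` on the axis `x₂ = 0`. -/
theorem lap_v_snd_zero (K : ℕ) (m : ℤ) : lap (v K) (m, 0) = 0 := by
  have h1 : v K (m, 0 - 1) = -v K (m, 1) := by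
    rw [show (0 : ℤ) - 1 = -1 by ring, v_neg_snd]
  have h2 : v K (m, 0 + 1) = v K (m, 1) := by rw [zero_add]
  simp only [lap]
  rw [h1, h2, v_snd_zero, v_snd_zero, v_snd_zero]
  ring

/-- [folklore] `Δv_K` in the open quadrant, in terms of the profile at the three radii `r − 1, r, r + 1`,
`r = a + b + 2` (the product rule `Δ(pg) = p·(radial second difference) + x₂δ₁g + x₁δ₂g`, with `Δ(x₁x₂) = 0`). -/
theorem lap_v_quadrant (K a b : ℕ) :
    lap (v K) ((a : ℤ) + 1, (b : ℤ) + 1) =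
      ((a : ℚ) + 2) * (b + 1) * g K (a + b + 3) + a * (b + 1) * g K (a + b + 1)
        + (a + 1) * (b + 2) * g K (a + b + 3) + (a + 1) * b * g K (a + b + 1)
        - 4 * ((a + 1) * (b + 1)) * g K (a + b + 2) := by
  have e1 : v K ((a : ℤ) + 1 + 1, (b : ℤ) + 1) = ((a + 2 : ℕ) : ℚ) * ((b + 1 : ℕ) : ℚ) * g K (a + b + 3) :=
    v_at K (by push_cast; ring) (by push_cast; ring) (by ring)
  have e2 : v K ((a : ℤ) + 1 - 1, (b : ℤ) + 1) = ((a : ℕ) : ℚ) * ((b + 1 : ℕ) : ℚ) * g K (a + b + 1) :=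
    v_at K (by ring) (by push_cast; ring) (by ring)
  have e3 : v K ((a : ℤ) + 1, (b : ℤ) + 1 + 1) = ((a + 1 : ℕ) : ℚ) * ((b + 2 : ℕ) : ℚ) * g K (a + b + 3) :=
    v_at K (by push_cast; ring) (by push_cast; ring) (by ring)
  have e4 : v K ((a : ℤ) + 1, (b : ℤ) + 1 - 1) = ((a + 1 : ℕ) : ℚ) * ((b : ℕ) : ℚ) * g K (a + b + 1) :=
    v_at K (by push_cast; ring) (by ring) (by ring)
  have e5 : v K ((a : ℤ) + 1, (b : ℤ) + 1) = ((a + 1 : ℕ) : ℚ) * ((b + 1 : ℕ) : ℚ) * g K (a + b + 2) :=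
    v_at K (by push_cast; ring) (by push_cast; ring) (by ring)
  simp only [lap]
  rw [e1, e2, e3, e4, e5]
  push_cast
  ring

/-- [folklore] CLOSED FORM in the open quadrant inside the support (`r = a + b + 2`, `r + 1 ≤ K`):
`Δv_K(a+1, b+1) = 2(a+1)(b+1)/(r(r+1)) − (2r+1)/(r+1) + 2r/K` — a number in `(−2, 1/2)`. -/
theorem lap_v_quadrant_closed (K a b : ℕ) (h : a + b + 3 ≤ K) :
    lap (v K) ((a : ℤ) + 1, (b : ℤ) + 1) =
      2 * ((a : ℚ) + 1) * (b + 1) / ((a + b + 2) * (a + b + 3)) - (2 * (a + b + 2) + 1) / (a + b + 3)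
        + 2 * (a + b + 2) / K := by
  rw [lap_v_quadrant,
    g_step (K := K) (r := a + b + 1) (s := a + b + 2) (by omega) (by omega),
    g_step (K := K) (r := a + b + 2) (s := a + b + 3) (by omega) h]
  have hK : (K : ℚ) ≠ 0 := by exact_mod_cast (show K ≠ 0 by omega)
  push_cast
  field_simp
  ring

/-- [folklore] The bound in the open quadrant: `|Δv_K(a+1, b+1)| ≤ 2` for all `a, b : ℕ` and all `K`
(inside the support by the closed form and `4(a+1)(b+1) ≤ r²`; at the edge `r = K` and beyond, all three profile
values vanish thanks to the taper). -/
theorem abs_lap_v_quadrant_le (K a b : ℕ) : |lap (v K) ((a : ℤ) + 1, (b : ℤ) + 1)| ≤ 2 := by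
  rcases Nat.lt_or_ge (a + b + 2) K with h | h
  · rw [lap_v_quadrant_closed K a b h]
    have ha : (0 : ℚ) ≤ a := Nat.cast_nonneg a
    have hb : (0 : ℚ) ≤ b := Nat.cast_nonneg b
    have hKq : ((a : ℚ) + b + 3) ≤ K := by exact_mod_cast h
    have hKpos : (0 : ℚ) < K := by linarith
    rw [abs_le]
    constructor
    · have h1 : 0 ≤ 2 * ((a : ℚ) + 1) * (b + 1) / ((a + b + 2) * (a + b + 3)) := by positivity
      have h2 : (2 * ((a : ℚ) + b + 2) + 1) / (a + b + 3) ≤ 2 := by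
        rw [div_le_iff₀ (by positivity)]
        linarith
      have h3 : 0 ≤ 2 * ((a : ℚ) + b + 2) / K := by positivity
      linarith
    · have h1 : 2 * ((a : ℚ) + 1) * (b + 1) / ((a + b + 2) * (a + b + 3)) ≤ 1 / 2 := by
        rw [div_le_iff₀ (by positivity)]
        nlinarith [sq_nonneg ((a : ℚ) - b)]
      have h2 : 1 ≤ (2 * ((a : ℚ) + b + 2) + 1) / (a + b + 3) := by
        rw [le_div_iff₀ (by positivity)]
        linarith
      have h3 : 2 * ((a : ℚ) + b + 2) / K ≤ 2 := by
        rw [div_le_iff₀ hKpos]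
        linarith
      linarith
  · rw [lap_v_quadrant]
    have e3 : g K (a + b + 3) = 0 := g_of_le (by omega)
    have e2 : g K (a + b + 2) = 0 := g_of_le h
    have e1 : g K (a + b + 1) = 0 := by
      rcases eq_or_lt_of_le h with hK | hK
      · rw [g_step (K := K) (r := a + b + 1) (s := a + b + 2) rfl (by omega), e2, hK]
        push_cast
        ring
      · exact g_of_le (by omega)
    rw [e1, e2, e3]
    norm_num

/-- [folklore] **`sup |Δ v_K| ≤ 2`**, uniformly in `K`: by the reflections `x₁ ↦ −x₁`, `x₂ ↦ −x₂` (under which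
`Δv_K` is odd) it suffices to treat the closed quadrant; on the axes `Δv_K = 0`, in the open quadrant
`abs_lap_v_quadrant_le`. -/
theorem abs_lap_v_le_two (K : ℕ) (x : Site) : |lap (v K) x| ≤ 2 := by
  obtain ⟨m, n⟩ := x
  suffices H : ∀ m n : ℤ, 0 ≤ m → 0 ≤ n → |lap (v K) (m, n)| ≤ 2 by
    rcases le_or_gt 0 m with hm | hm <;> rcases le_or_gt 0 n with hn | hn
    · exact H m n hm hn
    · have h := H m (-n) hm (by omega)
      rwa [lap_v_neg_snd, abs_neg] at h
    · have h := H (-m) n (by omega) hn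
      rwa [lap_v_neg_fst, abs_neg] at h
    · have h := H (-m) (-n) (by omega) (by omega)
      rwa [lap_v_neg_fst, abs_neg, lap_v_neg_snd, abs_neg] at h
  intro m n hm hn
  rcases eq_or_lt_of_le hm with hm0 | hm'
  · rw [← hm0, lap_v_fst_zero]; norm_num
  rcases eq_or_lt_of_le hn with hn0 | hn'
  · rw [← hn0, lap_v_snd_zero]; norm_num
  obtain ⟨a, rfl⟩ : ∃ a : ℕ, m = (a : ℤ) + 1 := ⟨(m - 1).toNat, by omega⟩
  obtain ⟨b, rfl⟩ : ∃ b : ℕ, n = (b : ℤ) + 1 := ⟨(n - 1).toNat, by omega⟩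
  exact abs_lap_v_quadrant_le K a b

/-- [folklore] The mixed difference at the origin is the profile at radius 2: `(∂₁∂₂v_K)(0) = v_K(1,1) = g K 2`. -/
theorem mixed_v_zero (K : ℕ) : mixed (v K) (0, 0) = g K 2 := by
  have e : v K (0 + 1, 0 + 1) = ((1 : ℕ) : ℚ) * ((1 : ℕ) : ℚ) * g K 2 :=
    v_at K (by simp) (by simp) rfl
  simp only [mixed]
  rw [e, v_fst_zero, v_fst_zero]
  have : v K (0 + 1, 0) = 0 := v_snd_zero K (0 + 1)
  rw [this]
  simp

/-- [folklore] **`(∂₁∂₂ v_K)(0) = H_K − 5/2 + 2/K`** for `2 ≤ K` — the logarithmically growing quantity. -/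
theorem mixed_v_zero_eq (K : ℕ) (hK : 2 ≤ K) : mixed (v K) (0, 0) = harmonic K - 5 / 2 + 2 / K := by
  rw [mixed_v_zero, g_two hK]

/-- [folklore] Sums of `v_K` over any finite set symmetric under `x₁ ↦ −x₁` vanish (oddness) — in particular
every block mean of `v_K` over such a block is zero (flat-model analogue of the averaging constraint). -/
theorem sum_v_reflect (K : ℕ) (S : Finset Site) (hS : ∀ x ∈ S, (-x.1, x.2) ∈ S) :
    ∑ x ∈ S, v K x = 0 := by
  have h : ∑ x ∈ S, v K x = ∑ x ∈ S, -v K x := by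
    refine Finset.sum_nbij' (fun x => (-x.1, x.2)) (fun x => (-x.1, x.2)) hS hS
      (fun x _ => by simp) (fun x _ => by simp) (fun x _ => ?_)
    obtain ⟨m, n⟩ := x
    show v K (m, n) = -v K (-m, n)
    rw [v_neg_fst]
    ring
  rw [Finset.sum_neg_distrib] at h
  linarith

/-- [folklore] Block means vanish: the sum of `v_K` over any box `[−M, M] × J` is zero. -/
theorem sum_v_box (K M : ℕ) (J : Finset ℤ) :
    ∑ x ∈ Finset.Icc (-(M : ℤ)) M ×ˢ J, v K x = 0 :=
  sum_v_reflect K _ (fun x hx => by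
    simp only [Finset.mem_product, Finset.mem_Icc] at hx ⊢
    exact ⟨⟨by omega, by omega⟩, hx.2⟩)

/-! ### §4 The lattice Dirichlet problem on a finite set: maximum principle and uniqueness -/

/-- [folklore] Discrete maximum principle: a function vanishing outside a finite set `S` and lattice-harmonic on
`S` is `≤ 0` everywhere (a maximiser with extremal first coordinate has a neighbour outside the maximising set). -/
theorem le_zero_of_lap_eq_zero (S : Finset Site) (w : Site → ℚ) (hout : ∀ x, x ∉ S → w x = 0)
    (hlap : ∀ x ∈ S, lap w x = 0) : ∀ x, w x ≤ 0 := by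
  intro x₀
  by_contra hcon
  have hx₀ : 0 < w x₀ := lt_of_not_ge hcon
  have hx₀S : x₀ ∈ S := by
    by_contra hx
    have := hout x₀ hx
    linarith
  obtain ⟨y, hyS, hy⟩ := Finset.exists_max_image S w ⟨x₀, hx₀S⟩
  have hMpos : 0 < w y := lt_of_lt_of_le hx₀ (hy x₀ hx₀S)
  have hle : ∀ z, w z ≤ w y := by
    intro z
    by_cases hz : z ∈ S
    · exact hy z hz
    · rw [hout z hz]; exact hMpos.le
  have hTne : (S.filter fun z => w z = w y).Nonempty := ⟨y, by simp [hyS]⟩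
  obtain ⟨z, hzT, hz⟩ := Finset.exists_max_image (S.filter fun z => w z = w y) (fun z => z.1) hTne
  rw [Finset.mem_filter] at hzT
  obtain ⟨hzS, hwz⟩ := hzT
  have h0 := hlap z hzS
  simp only [lap] at h0
  have h1 := hle (z.1 + 1, z.2)
  have h2 := hle (z.1 - 1, z.2)
  have h3 := hle (z.1, z.2 + 1)
  have h4 := hle (z.1, z.2 - 1)
  have heq : w (z.1 + 1, z.2) = w y := by linarith
  have hin : (z.1 + 1, z.2) ∈ S := by
    by_contra hx
    have := hout _ hx
    linarith
  have hinT : (z.1 + 1, z.2) ∈ S.filter (fun z => w z = w y) := by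
    rw [Finset.mem_filter]; exact ⟨hin, heq⟩
  have := hz _ hinT
  simp at this

/-- [folklore] Uniqueness for the lattice Dirichlet problem, homogeneous form: vanishing outside a finite `S` and
harmonic on `S` forces `w = 0`. -/
theorem eq_zero_of_lap_eq_zero (S : Finset Site) (w : Site → ℚ) (hout : ∀ x, x ∉ S → w x = 0)
    (hlap : ∀ x ∈ S, lap w x = 0) : ∀ x, w x = 0 := by
  intro x
  have h1 := le_zero_of_lap_eq_zero S w hout hlap x
  have h2 := le_zero_of_lap_eq_zero S (fun y => -w y) (fun y hy => by simp [hout y hy])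
    (fun y hy => by rw [lap_neg, hlap y hy, neg_zero]) x
  simp only [neg_nonpos] at h2
  linarith

/-- [folklore] UNIQUENESS of the lattice Dirichlet problem on a finite set `S`: two functions vanishing outside `S`
with the same Laplacian on `S` coincide.  (So "`Δ_D⁻¹f`" is well defined as soon as it exists.) -/
theorem dirichlet_unique (S : Finset Site) (w₁ w₂ : Site → ℚ) (h₁ : ∀ x, x ∉ S → w₁ x = 0)
    (h₂ : ∀ x, x ∉ S → w₂ x = 0) (h : ∀ x ∈ S, lap w₁ x = lap w₂ x) : w₁ = w₂ := by
  funext x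
  have := eq_zero_of_lap_eq_zero S (fun y => w₁ y - w₂ y) (fun y hy => by simp [h₁ y hy, h₂ y hy])
    (fun y hy => by rw [lap_sub, h y hy, sub_self]) x
  linarith

/-- [folklore] **The witness is the Dirichlet solution of its own datum.**  On any finite `S` containing the
support ball of `v_K` (every site outside `S` has `|x₁| + |x₂| ≥ K − 1`), the solution `w` of `Δw = f` on `S`,
`w = 0` off `S`, with datum `f := Δv_K` (so `sup|f| ≤ 2`), has `(∂₁∂₂w)(0) = H_K − 5/2 + 2/K` — the object whose
growth the numerics N-B8-4 measured. -/
theorem mixed_dirichlet_solution (K : ℕ) (hK : 2 ≤ K) (S : Finset Site)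
    (hS : ∀ x : Site, x ∉ S → K ≤ x.1.natAbs + x.2.natAbs + 1)
    (w : Site → ℚ) (hw : ∀ x, x ∉ S → w x = 0) (hlap : ∀ x ∈ S, lap w x = lap (v K) x) :
    mixed w (0, 0) = harmonic K - 5 / 2 + 2 / K := by
  have hwv : w = v K :=
    dirichlet_unique S w (v K) hw (fun x hx => v_eq_zero_of_le K x (hS x hx)) hlap
  rw [hwv]
  exact mixed_v_zero_eq K hK

/-! ### §5 Consequences: logarithmic growth, no uniform constant, count in scales -/

/-- [folklore] **`log(K+1) − 5/2 ≤ (∂₁∂₂v_K)(0)`** (`2 ≤ K`), from Mathlib's `log_add_one_le_harmonic`. -/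
theorem log_le_mixed_v_zero (K : ℕ) (hK : 2 ≤ K) :
    Real.log ((K : ℝ) + 1) - 5 / 2 ≤ ((mixed (v K) (0, 0) : ℚ) : ℝ) := by
  rw [mixed_v_zero_eq K hK]
  have h1 := log_add_one_le_harmonic K
  push_cast at h1 ⊢
  have h2 : (0 : ℝ) ≤ 2 / (K : ℝ) := by positivity
  linarith

/-- [folklore] **NO UNIFORM CONSTANT.**  For every `C` there are `K` and a lattice function `w` (namely `v_K`),
vanishing wherever `|x₁| + |x₂| ≥ K − 1`, with `|Δw| ≤ 2` everywhere and `(∂₁∂₂w)(0) > C`. -/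
theorem no_uniform_sup_hessian_bound (C : ℝ) :
    ∃ K : ℕ, ∃ w : Site → ℚ,
      (∀ x, |lap w x| ≤ 2) ∧ (∀ x : Site, K ≤ x.1.natAbs + x.2.natAbs + 1 → w x = 0) ∧
        C < ((mixed w (0, 0) : ℚ) : ℝ) := by
  obtain ⟨N, hN⟩ := exists_nat_gt (Real.exp (C + 5 / 2))
  refine ⟨max N 2, v (max N 2), abs_lap_v_le_two _, fun x hx => v_eq_zero_of_le _ x hx, ?_⟩
  have hK : 2 ≤ max N 2 := le_max_right _ _
  have h1 := log_le_mixed_v_zero (max N 2) hK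
  have hN' : (N : ℝ) ≤ ((max N 2 : ℕ) : ℝ) := by exact_mod_cast le_max_left N 2
  have h2 : C + 5 / 2 < Real.log (((max N 2 : ℕ) : ℝ) + 1) := by
    rw [Real.lt_log_iff_exp_lt (by positivity)]
    linarith
  linarith

/-- [folklore] The negated uniform estimate: there is NO constant `C` with `|∂₁∂₂w(x)| ≤ C·B` for all finitely
supported lattice functions `w` with `|Δw| ≤ B` everywhere — i.e. no bound `sup|∂₁∂₂w| ≤ C·sup|Δw|`
(equivalently, by `dirichlet_unique`, no bound `sup|∂₁∂₂Δ_D⁻¹f| ≤ C·sup|f|` uniform in the box). -/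
theorem not_exists_uniform_constant :
    ¬ ∃ C : ℚ, ∀ (w : Site → ℚ) (B : ℚ),
      (∃ R : ℕ, ∀ x : Site, R ≤ x.1.natAbs + x.2.natAbs → w x = 0) →
        (∀ x, |lap w x| ≤ B) → ∀ x, |mixed w x| ≤ C * B := by
  rintro ⟨C, hC⟩
  obtain ⟨K, w, hlap, hsupp, hmix⟩ := no_uniform_sup_hessian_bound (2 * C)
  have h := hC w 2 ⟨K, fun x hx => hsupp x (by omega)⟩ hlap (0, 0)
  have h' : mixed w (0, 0) ≤ C * 2 := (abs_le.mp h).2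
  have h'' : ((mixed w (0, 0) : ℚ) : ℝ) ≤ ((C * 2 : ℚ) : ℝ) := by exact_mod_cast h'
  push_cast at h'' hmix
  linarith

/-- [folklore] **Count in scales.**  With `K = L^k` (`L ≥ 2` the scale ratio, `k ≥ 1` the number of scales; the
witness then lives in a box of `≤ 2L^k` lattice points per side): `k·log L − 5/2 ≤ (∂₁∂₂ v_{L^k})(0)` while
`|Δ v_{L^k}| ≤ 2` — the ratio grows at least linearly in `k`, rate `≥ (log L)/2` per scale. -/
theorem scales_lower_bound (L k : ℕ) (hL : 2 ≤ L) (hk : 1 ≤ k) :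
    (k : ℝ) * Real.log L - 5 / 2 ≤ ((mixed (v (L ^ k)) (0, 0) : ℚ) : ℝ) := by
  have hK : 2 ≤ L ^ k := le_trans hL (by
    calc L = L ^ 1 := (pow_one L).symm
      _ ≤ L ^ k := Nat.pow_le_pow_right (by omega) hk)
  have h1 := log_le_mixed_v_zero (L ^ k) hK
  have hLpos : (0 : ℝ) < L := by exact_mod_cast (show 0 < L by omega)
  have h2 : (k : ℝ) * Real.log L ≤ Real.log (((L ^ k : ℕ) : ℝ) + 1) := by
    rw [← Real.log_pow]
    apply Real.log_le_log (pow_pos hLpos k)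
    push_cast
    linarith
  linarith

/-! ### §6 The `d = 4` reading: functions constant along `x₃, x₄` -/

/-- [folklore] Sites of `ℤ⁴`. -/
abbrev Site4 : Type := ℤ × ℤ × ℤ × ℤ

/-- [folklore] The nine-point Laplacian on `ℤ⁴` (unit spacing). -/
def lap4 (w : Site4 → ℚ) (y : Site4) : ℚ :=
  w (y.1 + 1, y.2.1, y.2.2.1, y.2.2.2) + w (y.1 - 1, y.2.1, y.2.2.1, y.2.2.2)
    + w (y.1, y.2.1 + 1, y.2.2.1, y.2.2.2) + w (y.1, y.2.1 - 1, y.2.2.1, y.2.2.2)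
    + w (y.1, y.2.1, y.2.2.1 + 1, y.2.2.2) + w (y.1, y.2.1, y.2.2.1 - 1, y.2.2.2)
    + w (y.1, y.2.1, y.2.2.1, y.2.2.2 + 1) + w (y.1, y.2.1, y.2.2.1, y.2.2.2 - 1) - 8 * w y

/-- [folklore] The forward mixed difference `∂₁∂₂` on `ℤ⁴`. -/
def mixed4 (w : Site4 → ℚ) (y : Site4) : ℚ :=
  w (y.1 + 1, y.2.1 + 1, y.2.2) - w (y.1 + 1, y.2.1, y.2.2) - w (y.1, y.2.1 + 1, y.2.2) + w y

/-- [folklore] Lift of a `ℤ²` function to `ℤ⁴`, constant along `x₃, x₄`. -/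
def lift (w : Site → ℚ) : Site4 → ℚ := fun y => w (y.1, y.2.1)

/-- [folklore] The `ℤ⁴` Laplacian of a lift is the `ℤ²` Laplacian (the `x₃, x₄` differences vanish). -/
theorem lap4_lift (w : Site → ℚ) (y : Site4) : lap4 (lift w) y = lap w (y.1, y.2.1) := by
  simp only [lap4, lift, lap]
  ring

/-- [folklore] `∂₁∂₂` of a lift is the `ℤ²` mixed difference. -/
theorem mixed4_lift (w : Site → ℚ) (y : Site4) : mixed4 (lift w) y = mixed w (y.1, y.2.1) := by
  simp only [mixed4, lift, mixed]

/-- [folklore] The `d = 4` form of `no_uniform_sup_hessian_bound` (cylindrical support: the lift vanishes wherever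
`|y₁| + |y₂| ≥ K − 1`). -/
theorem no_uniform_sup_hessian_bound4 (C : ℝ) :
    ∃ K : ℕ, ∃ w : Site4 → ℚ,
      (∀ y, |lap4 w y| ≤ 2) ∧ (∀ y : Site4, K ≤ y.1.natAbs + y.2.1.natAbs + 1 → w y = 0) ∧
        C < ((mixed4 w (0, 0, 0, 0) : ℚ) : ℝ) := by
  obtain ⟨K, w, hlap, hsupp, hmix⟩ := no_uniform_sup_hessian_bound C
  refine ⟨K, lift w, fun y => ?_, fun y hy => ?_, ?_⟩
  · rw [lap4_lift]; exact hlap _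
  · exact hsupp (y.1, y.2.1) hy
  · rw [mixed4_lift]; exact hmix

/-! ### Sanity values (kernel-evaluated; they agree with the exact engine `witness_check.py`, `K = 4`) -/

/-- [folklore] `(∂₁∂₂ v₄)(0) = H₄ − 5/2 + 1/2 = 1/12`. -/
example : mixed (v 4) (0, 0) = 1 / 12 := by
  rw [mixed_v_zero_eq 4 (by norm_num)]
  simp only [harmonic, Finset.sum_range_succ, Finset.sum_range_zero]
  norm_num

/-- [folklore] `Δv₄(1, 1) = 2/(2·3) − 5/3 + 4/4 = −1/3` (the extremal value for `K = 4`: `sup|Δv₄| = 1/3`). -/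
example : lap (v 4) (((0 : ℕ) : ℤ) + 1, ((0 : ℕ) : ℤ) + 1) = -1 / 3 := by
  rw [lap_v_quadrant_closed 4 0 0 (by norm_num)]
  norm_num

/-! ### §7 (v1.1) The Hölder clause of (1.36) under `|f|₍₋₂₎`-sources, and the gradient of the source versus the
source: third differences of the witness versus its Laplacian (power-law failure `N^β`, resp. ratio `N`)

[v1.2 ERRATUM: v1.1 titled the second item «the `Δ`-clause of (1.39)» — RETRACTED, module docstring (v)–(vii): the
(1.39) operators are the covariant curl–curl and the Wilson Hessian of [4] (3.10), zero on this model (§8).]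
Flat pure-gauge model (module docstring, §7 paragraph): `A = ∇^ηλ`, `f = Δ^ηλ`; in lattice units the Hölder clause
demands `(η-neighbour jump of a Hessian component of λ̃) ≤ C·N^{−β}·sup|lap λ̃|`, and the gradient hypothesis on the
source added by GAPS G-B8-13 would follow from the printed one iff `|∂_ν lap λ̃| ≤ C·N^{−1}·sup|lap λ̃|`, `N = L^j` the
number of lattice points per block scale.  Everything below is an elementary kernel fact about explicit lattice
functions on `ℤ²` (and their lifts to `ℤ⁴`); tag [folklore]. -/

/-- [folklore] Forward difference along `e₁`: `(∂₁w)(x) = w(x + e₁) − w(x)`. -/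
def d1 (w : Site → ℚ) (x : Site) : ℚ := w (x.1 + 1, x.2) - w x

/-- [folklore] Forward difference along `e₂`: `(∂₂w)(x) = w(x + e₂) − w(x)`. -/
def d2 (w : Site → ℚ) (x : Site) : ℚ := w (x.1, x.2 + 1) - w x

/-- [folklore] The mixed second difference of §1 is the iterated forward difference `∂₁∂₂ = ∂₁ ∘ ∂₂`. -/
theorem mixed_eq_d1_d2 (w : Site → ℚ) (x : Site) : mixed w x = d1 (d2 w) x := by
  simp only [mixed, d1, d2]
  ring

/-- [folklore] Symmetry of the lattice Hessian: `∂₁ ∘ ∂₂ = ∂₂ ∘ ∂₁`. -/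
theorem mixed_eq_d2_d1 (w : Site → ℚ) (x : Site) : mixed w x = d2 (d1 w) x := by
  simp only [mixed, d1, d2]
  ring

/-- [folklore] **Flat-lattice commutation `∂₁Δ = Δ∂₁`.**  In the flat pure-gauge model (`A_ν = ∇^η_νλ`,
`f = Δ^ηλ`) this is the identity `Δ^η(A₁) = ∇^η₁ f` for the COMPONENTWISE Laplacian of the gradient field.  [v1.2
ERRATUM: v1.1 added «the `Δ^η_{U₀}A`-member of (1.39) IS the gradient of the source» — RETRACTED: the (1.39) operator on
bond functions is the Wilson Hessian `D*D + Δ′` of [4] (3.10), which annihilates `A = ∇^ηλ` in the flat model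
(`curl_grad_eq_zero`, §8); module docstring (v), (vii).] -/
theorem d1_lap (w : Site → ℚ) (x : Site) : d1 (lap w) x = lap (d1 w) x := by
  obtain ⟨m, n⟩ := x
  simp only [d1, lap, sub_add_cancel, add_sub_cancel_right]
  ring

/-- [folklore] Flat-lattice commutation `∂₂Δ = Δ∂₂` (`(Δ^ηA)₂ = ∇^η₂ f` in the model). -/
theorem d2_lap (w : Site → ℚ) (x : Site) : d2 (lap w) x = lap (d2 w) x := by
  obtain ⟨m, n⟩ := x
  simp only [d2, lap, sub_add_cancel, add_sub_cancel_right]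
  ring

/-- [folklore] **The Laplacian is the trace of the lattice Hessian**:
`Δw(x) = (∂₁∂₁w)(x − e₁) + (∂₂∂₂w)(x − e₂)` (forward second differences recentred). -/
theorem lap_eq_trace (w : Site → ℚ) (x : Site) :
    lap w x = d1 (d1 w) (x.1 - 1, x.2) + d2 (d2 w) (x.1, x.2 - 1) := by
  obtain ⟨m, n⟩ := x
  simp only [lap, d1, d2, sub_add_cancel]
  ring

/-- [folklore] Hence the jumps of the source `Δw` between any two sites are dominated by the jumps of the two
diagonal Hessian components between the correspondingly shifted sites: an `η`-scale `β`-Hölder bound on `Hess w`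
(the Hölder clause of (1.36) for `∇A ⊇ Hess λ`) forces the same bound, times `d`, on `f = Δλ` itself — a hypothesis
on `f` which `|f|₍₋₂₎ < γ(α₀ + α₁)` does not contain. -/
theorem abs_lap_sub_lap_le (w : Site → ℚ) (x y : Site) :
    |lap w x - lap w y| ≤
      |d1 (d1 w) (x.1 - 1, x.2) - d1 (d1 w) (y.1 - 1, y.2)|
        + |d2 (d2 w) (x.1, x.2 - 1) - d2 (d2 w) (y.1, y.2 - 1)| := by
  rw [lap_eq_trace w x, lap_eq_trace w y,
    show ∀ a b c e : ℚ, a + b - (c + e) = (a - c) + (b - e) from fun a b c e => by ring]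
  exact abs_add_le _ _

/-- [folklore] The mixed difference of the witness one step off the origin:
`(∂₁∂₂v_K)(1, 0) = 2·g K 3 − g K 2 = g K 2 − 2/3 + 2/K` (`3 ≤ K`). -/
theorem mixed_v_one_zero (K : ℕ) (hK : 3 ≤ K) : mixed (v K) (1, 0) = g K 2 - 2 / 3 + 2 / K := by
  have e1 : v K (1 + 1, 0 + 1) = ((2 : ℕ) : ℚ) * ((1 : ℕ) : ℚ) * g K 3 :=
    v_at K (by norm_num) (by norm_num) rfl
  have e2 : v K (1 + 1, 0) = 0 := v_snd_zero K (1 + 1)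
  have e3 : v K (1, 0 + 1) = ((1 : ℕ) : ℚ) * ((1 : ℕ) : ℚ) * g K 2 :=
    v_at K (by norm_num) (by norm_num) rfl
  have e4 : v K (1, 0) = 0 := v_snd_zero K 1
  simp only [mixed]
  rw [e1, e2, e3, e4, g_step (K := K) (r := 2) (s := 3) rfl hK]
  push_cast
  ring

/-- [folklore] **Hölder-clause witness value**: the `e₁`-nearest-neighbour jump of the Hessian component `∂₁∂₂v_K`
at the origin, `(∂₁∂₂v_K)(1, 0) − (∂₁∂₂v_K)(0, 0) = −2/3 + 2/K` (`3 ≤ K`) — for each `K ≥ 4` a FIXED nonzero number,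
whereas the clause would require it to be `≤ C·N^{−β}·sup|Δv_K| ≤ 2C·N^{−β}` in every region scale `N`. -/
theorem mixed_v_jump (K : ℕ) (hK : 3 ≤ K) :
    mixed (v K) (1, 0) - mixed (v K) (0, 0) = -(2 / 3) + 2 / K := by
  rw [mixed_v_one_zero K hK, mixed_v_zero K]
  ring

/-- [folklore] The same jump written with the forward difference: `(∂₁(∂₁∂₂v_K))(0) = −2/3 + 2/K` (`3 ≤ K`). -/
theorem d1_mixed_v_origin (K : ℕ) (hK : 3 ≤ K) : d1 (mixed (v K)) (0, 0) = -(2 / 3) + 2 / K := by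
  have h := mixed_v_jump K hK
  simp only [d1]
  rw [zero_add]
  exact h

/-- [folklore] **Gradient-of-source witness value** [v1.1 label «(1.39)-clause witness value» RETRACTED, module
docstring (vii)]: the `e₁`-difference of the source `Δv_K` next to the axis,
`Δv_K(1, 1) − Δv_K(0, 1) = −4/3 + 4/K` (`3 ≤ K`; `Δv_K` vanishes on the axis and equals the closed form
`lap_v_quadrant_closed` at `(1,1)`) — i.e. `|∇Δv_K| ≥ 4/3 − 4/K` while `sup|Δv_K| ≤ 2`. -/
theorem lap_v_jump (K : ℕ) (hK : 3 ≤ K) :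
    lap (v K) (1, 1) - lap (v K) (0, 1) = -(4 / 3) + 4 / K := by
  have h1 := lap_v_quadrant_closed K 0 0 (by omega)
  have h2 : lap (v K) (0, 1) = 0 := lap_v_fst_zero K 1
  simp only [Nat.cast_zero, zero_add] at h1
  rw [h1, h2]
  ring

/-- [folklore] The same difference written with `d1`: `(∂₁Δv_K)(0, 1) = −4/3 + 4/K` (`3 ≤ K`). -/
theorem d1_lap_v (K : ℕ) (hK : 3 ≤ K) : d1 (lap (v K)) (0, 1) = -(4 / 3) + 4 / K := by
  have h := lap_v_jump K hK
  simp only [d1]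
  rw [zero_add]
  exact h

/-- [folklore] For `K ≥ 4` the Hessian jump of the witness is at least `1/6` in modulus. -/
theorem abs_mixed_v_jump_ge (K : ℕ) (hK : 4 ≤ K) :
    1 / 6 ≤ |mixed (v K) (1, 0) - mixed (v K) (0, 0)| := by
  rw [mixed_v_jump K (by omega)]
  have hKq : (4 : ℚ) ≤ K := by exact_mod_cast hK
  have hKpos : (0 : ℚ) < K := by linarith
  have h : 2 / (K : ℚ) ≤ 1 / 2 := by
    rw [div_le_iff₀ hKpos]
    linarith
  rw [abs_of_nonpos (by linarith)]
  linarith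

/-- [folklore] For `K ≥ 4` the source-gradient of the witness is at least `1/3` in modulus. -/
theorem abs_lap_v_jump_ge (K : ℕ) (hK : 4 ≤ K) :
    1 / 3 ≤ |lap (v K) (1, 1) - lap (v K) (0, 1)| := by
  rw [lap_v_jump K (by omega)]
  have hKq : (4 : ℚ) ≤ K := by exact_mod_cast hK
  have hKpos : (0 : ℚ) < K := by linarith
  have h : 4 / (K : ℚ) ≤ 1 := by
    rw [div_le_iff₀ hKpos]
    linarith
  rw [abs_of_nonpos (by linarith)]
  linarith

/-- [folklore] The fixed bump `v₄` (support: the four sites `(±1, ±1)`): Hessian jump `−1/6` at the origin. -/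
theorem mixed_v4_jump : mixed (v 4) (1, 0) - mixed (v 4) (0, 0) = -(1 / 6) := by
  rw [mixed_v_jump 4 (by norm_num)]
  norm_num

/-- [folklore] The fixed bump `v₄`: source-gradient `−1/3` next to the axis. -/
theorem lap_v4_jump : lap (v 4) (1, 1) - lap (v 4) (0, 1) = -(1 / 3) := by
  rw [lap_v_jump 4 (by norm_num)]
  norm_num

/-- [folklore] ADMISSIBILITY (the flat `λ ∈ N(Q′)`): the witness `v_K` has ZERO SUM over every finite set of sites
containing the box `[−M, M]²`, `K ≤ M + 2` (which contains its support); hence, as soon as that box lies inside one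
averaging block, every block mean of `v_K` vanishes (blocks missing the support trivially, the block containing it by
this lemma).  For the fixed bump `v₄` of this section: any block of side `≥ 5` lattice points suitably placed. -/
theorem sum_v_eq_zero_of_box_subset (K M : ℕ) (hM : K ≤ M + 2) (S : Finset Site)
    (hS : Finset.Icc (-(M : ℤ)) M ×ˢ Finset.Icc (-(M : ℤ)) M ⊆ S) : ∑ x ∈ S, v K x = 0 := by
  rw [← Finset.sum_subset hS ?_]
  · exact sum_v_box K M _
  · intro x _ hx
    apply v_eq_zero_of_le
    simp only [Finset.mem_product, Finset.mem_Icc, not_and_or, not_le] at hx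
    have h1 : x.1 ≤ (x.1.natAbs : ℤ) := Int.le_natAbs
    have h2 : -x.1 ≤ (x.1.natAbs : ℤ) := by
      have h := @Int.le_natAbs (-x.1)
      rwa [Int.natAbs_neg] at h
    have h3 : x.2 ≤ (x.2.natAbs : ℤ) := Int.le_natAbs
    have h4 : -x.2 ≤ (x.2.natAbs : ℤ) := by
      have h := @Int.le_natAbs (-x.2)
      rwa [Int.natAbs_neg] at h
    omega

/-- [folklore] **NO UNIFORM HÖLDER CONSTANT — power-law failure of the Hölder clause of (1.36) under
`|f|₍₋₂₎`-sources.**  For every exponent `β > 0` there is NO constant `C` such that for every region scale `N ≥ 4`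
(lattice points per block scale, `N = L^j`) and every lattice function `w` supported within `|x₁| + |x₂| ≤ N − 2`
with `|Δw| ≤ B` everywhere, the `e₁`-nearest-neighbour jumps of the Hessian component `∂₁∂₂w` are
`≤ C · N^{−β} · B` — the estimate shape which the clause `‖A‖_{1,β} < B₂(β₀)(α₀ + α₁)(L^jη)^{−2−β}`, already restricted
to one component and to `η`-neighbour pairs, would instantiate in the flat pure-gauge model together with the printed
hypothesis (`C = B₂(β₀)/γ`).  Witness: the FIXED bump `v₄` (jump `1/6`, `|Δv₄| ≤ 2`, admissible for every `N ≥ 4`)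
against `2C · N^{−β} → 0`; quantitatively the constant needed at scale `N` is `≥ N^β/12`. -/
theorem not_exists_uniform_holder_constant (β : ℝ) (hβ : 0 < β) :
    ¬ ∃ C : ℝ, ∀ N : ℕ, 4 ≤ N → ∀ (w : Site → ℚ) (B : ℚ),
      (∀ x : Site, N ≤ x.1.natAbs + x.2.natAbs + 1 → w x = 0) → (∀ x, |lap w x| ≤ B) →
        ∀ x : Site, |((d1 (mixed w) x : ℚ) : ℝ)| ≤ C * ((N : ℝ) ^ β)⁻¹ * (B : ℝ) := by
  rintro ⟨C, hC⟩
  -- a region scale `N ≥ 4` at which `2C·N^{−β} < 1/6`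
  obtain ⟨N, hN4, hN⟩ : ∃ N : ℕ, 4 ≤ N ∧ C * ((N : ℝ) ^ β)⁻¹ * 2 < 1 / 6 := by
    rcases le_or_gt C 0 with hC0 | hC0
    · refine ⟨4, le_rfl, ?_⟩
      have h4 : (0 : ℝ) < ((4 : ℕ) : ℝ) ^ β := by positivity
      have : C * (((4 : ℕ) : ℝ) ^ β)⁻¹ * 2 ≤ 0 :=
        mul_nonpos_of_nonpos_of_nonneg (mul_nonpos_of_nonpos_of_nonneg hC0 (by positivity)) (by norm_num)
      linarith
    · obtain ⟨N, hN⟩ := exists_nat_gt ((12 * C) ^ (1 / β))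
      refine ⟨max N 4, le_max_right _ _, ?_⟩
      have hge : (4 : ℝ) ≤ ((max N 4 : ℕ) : ℝ) := by exact_mod_cast le_max_right N 4
      have hNle : (N : ℝ) ≤ ((max N 4 : ℕ) : ℝ) := by exact_mod_cast le_max_left N 4
      have h1 : (12 * C) ^ (1 / β) < ((max N 4 : ℕ) : ℝ) := lt_of_lt_of_le hN hNle
      have h2 : 12 * C < ((max N 4 : ℕ) : ℝ) ^ β := by
        have h := Real.rpow_lt_rpow (by positivity : (0 : ℝ) ≤ (12 * C) ^ (1 / β)) h1 hβ
        rwa [← Real.rpow_mul (by positivity : (0 : ℝ) ≤ 12 * C), one_div_mul_cancel hβ.ne',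
          Real.rpow_one] at h
      have h3 : (0 : ℝ) < ((max N 4 : ℕ) : ℝ) ^ β := Real.rpow_pos_of_pos (by linarith) β
      rw [show C * (((max N 4 : ℕ) : ℝ) ^ β)⁻¹ * 2 = 2 * C / ((max N 4 : ℕ) : ℝ) ^ β by ring,
        div_lt_iff₀ h3]
      linarith
  -- the fixed bump `v₄` is admissible at scale `N` and violates the bound
  have h := hC N hN4 (v 4) 2 (fun x hx => v_eq_zero_of_le 4 x (le_trans hN4 hx)) (abs_lap_v_le_two 4) (0, 0)
  have hval : ((d1 (mixed (v 4)) (0, 0) : ℚ) : ℝ) = -(1 / 6) := by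
    rw [d1_mixed_v_origin 4 (by norm_num)]
    push_cast
    norm_num
  rw [hval] at h
  have habs : |(-(1 / 6) : ℝ)| = 1 / 6 := by norm_num
  rw [habs] at h
  push_cast at h
  linarith

/-- [folklore] **NO UNIFORM CONSTANT BOUNDING THE GRADIENT OF THE SOURCE BY THE SOURCE — the hypothesis GAPS G-B8-13
adds (`|D^η_{U₀}f|₍₋₃₎ ≲ α₀ + α₁`) is stronger than the printed `|f|₍₋₂₎ ≲ α₀ + α₁` by the factor `N` at block scale
`N`.**  There is NO constant `C` such that for every region scale `N ≥ 4` and every lattice function `w` supported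
within `|x₁| + |x₂| ≤ N − 2` with `|Δw| ≤ B` everywhere, `|∂₁Δw| ≤ (C/N) · B`.  Witness: the fixed bump `v₄`
(`|∂₁Δv₄(0,1)| = 1/3`, `|Δv₄| ≤ 2`) against `2C/N → 0`; the constant needed at scale `N` is `≥ N/6`.  [v1.2 ERRATUM:
v1.1 titled this «NO UNIFORM CONSTANT FOR THE `Δ`-CLAUSE OF (1.39)», reading `Δ^η_{U₀}A` componentwise (`= ∇^η f` by
`d1_lap`) — RETRACTED: the (1.39) operators are the covariant curl–curl `D*D` and the Wilson Hessian `D*D + Δ′` of [4]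
(3.10), both ZERO on the flat pure-gauge model (`curl_grad_eq_zero`, §8), so this theorem says nothing about (1.39);
module docstring (v), (vii).] -/
theorem not_exists_uniform_grad_lap_constant :
    ¬ ∃ C : ℚ, ∀ N : ℕ, 4 ≤ N → ∀ (w : Site → ℚ) (B : ℚ),
      (∀ x : Site, N ≤ x.1.natAbs + x.2.natAbs + 1 → w x = 0) → (∀ x, |lap w x| ≤ B) →
        ∀ x : Site, |d1 (lap w) x| ≤ C / N * B := by
  rintro ⟨C, hC⟩
  obtain ⟨N, hN⟩ := exists_nat_gt (max (6 * C) 4)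
  have hN4q : (4 : ℚ) < N := lt_of_le_of_lt (le_max_right _ _) hN
  have hNC : 6 * C < N := lt_of_le_of_lt (le_max_left _ _) hN
  have hN4 : 4 ≤ N := by exact_mod_cast hN4q.le
  have hNpos : (0 : ℚ) < N := by linarith
  have h := hC N hN4 (v 4) 2 (fun x hx => v_eq_zero_of_le 4 x (le_trans hN4 hx)) (abs_lap_v_le_two 4) (0, 1)
  rw [d1_lap_v 4 (by norm_num)] at h
  have habs : |(-(4 / 3) + 4 / ((4 : ℕ) : ℚ) : ℚ)| = 1 / 3 := by norm_num
  rw [habs] at h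
  -- `1/3 ≤ (C/N)·2` contradicts `N > 6C`
  have h' : (N : ℚ) ≤ 6 * C := by
    have h2 : 1 / 3 * (N : ℚ) ≤ 2 * C := by
      rw [show C / (N : ℚ) * 2 = 2 * C / N by ring] at h
      exact (le_div_iff₀ hNpos).mp h
    linarith
  linarith

/-- [folklore] The `d = 4` reading of §7 (lift constant along `x₃, x₄`; cylindrical support of radius `2`): a lattice
function on `ℤ⁴` with `|Δw| ≤ 2`, vanishing wherever `|y₁| + |y₂| ≥ 3`, whose Hessian component `∂₁∂₂w` jumps by
`−1/6` between the origin and `e₁` and whose source `Δw` jumps by `−1/3` between `e₂` and `e₁ + e₂`.  [v1.2: the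
`139` in the name is the retracted v1.1 label (module docstring (vii)), kept under append-only naming; the fourth
conjunct is the gradient-of-source jump, not a (1.39) quantity.] -/
theorem holder_and_139_witness4 :
    ∃ w : Site4 → ℚ, (∀ y, |lap4 w y| ≤ 2) ∧ (∀ y : Site4, 4 ≤ y.1.natAbs + y.2.1.natAbs + 1 → w y = 0) ∧
      mixed4 w (1, 0, 0, 0) - mixed4 w (0, 0, 0, 0) = -(1 / 6) ∧
        lap4 w (1, 1, 0, 0) - lap4 w (0, 1, 0, 0) = -(1 / 3) := by
  refine ⟨lift (v 4), fun y => ?_, fun y hy => ?_, ?_, ?_⟩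
  · rw [lap4_lift]
    exact abs_lap_v_le_two 4 _
  · exact v_eq_zero_of_le 4 (y.1, y.2.1) hy
  · rw [mixed4_lift, mixed4_lift]
    exact mixed_v4_jump
  · rw [lap4_lift, lap4_lift]
    exact lap_v4_jump

/-! ### Sanity values for §7 (kernel-evaluated; they agree with the exact engine `witness_check_v11.py`) -/

/-- [folklore] `(∂₁∂₂v₄)(1,0) − (∂₁∂₂v₄)(0,0) = −2/3 + 2/4 = −1/6`. -/
example : d1 (mixed (v 4)) (0, 0) = -1 / 6 := by
  rw [d1_mixed_v_origin 4 (by norm_num)]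
  norm_num

/-- [folklore] `Δv₄(1,1) − Δv₄(0,1) = −4/3 + 1 = −1/3`. -/
example : d1 (lap (v 4)) (0, 1) = -1 / 3 := by
  rw [d1_lap_v 4 (by norm_num)]
  norm_num

/-- [folklore] `Δv₆(1,1) − Δv₆(0,1) = −4/3 + 2/3 = −2/3`. -/
example : lap (v 6) (1, 1) - lap (v 6) (0, 1) = -2 / 3 := by
  rw [lap_v_jump 6 (by norm_num)]
  norm_num

/-! ### §8 (v1.2, ERRATUM support) The plaquette field of a pure gauge vanishes — the flat model is silent on
(1.39); and `Δ = ∂*∂` on scalars (the source is the divergence of the gradient field)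

[4] p. 392 (3.8)–(3.10) (PRINTED, module docstring): on bond functions `D^η_U` is the covariant exterior derivative
(bonds → plaquettes) and `Δ^η(U) = D*D + Δ′` the Wilson-action Hessian, «generalizing the operator ∂*∂ in the Abelian
case».  In the flat model the `(1,2)`-plaquette value of `∂A` for the gradient field `A = (∂₁w, ∂₂w)` is
`∂₁A₂ − ∂₂A₁ = ∂₁∂₂w − ∂₂∂₁w = 0`, so `D*DA = 0` and `Δ^η_{U₀}A = 0` (`Δ′ = 0` at `U₀ = 1`); while the backward
divergence of `A` is the scalar Laplacian `Δw = f` ((1.146) in the model: `D^{η*}_{U₀}A = f`, the bond → site adjoint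
(3.8)), whose gradient `∂_ν f = Δ(A_ν)` (`d1_lap`) is the `∂∂*`-part of the componentwise (Hodge) Laplacian of `A` —
the part (1.39) does not see. -/

/-- [folklore] **`curl ∘ grad = 0` on the lattice**: `∂₁(∂₂w) − ∂₂(∂₁w) = 0` at every site — the plaquette field
`D^ηA` of the flat pure-gauge configuration `A = ∇^ηw` vanishes identically, hence so do BOTH members `D^{η*}D^ηA`
and `Δ^η_{U₀}A = (D*D + Δ′)A` of (1.39) in the model: the model of §§1–7 carries NO information about (1.39)
(module docstring (v), (vii)). -/
theorem curl_grad_eq_zero (w : Site → ℚ) (x : Site) : d1 (d2 w) x - d2 (d1 w) x = 0 := by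
  rw [← mixed_eq_d1_d2, ← mixed_eq_d2_d1, sub_self]

/-- [folklore] In particular for the witness: the plaquette field of `A = ∇v_K` is zero everywhere, while (§7,
`lap_v_jump`) the componentwise Laplacian of `A` — the gradient of the source `Δv_K` — jumps by `−4/3 + 4/K` next to
the axis. -/
theorem curl_grad_v_eq_zero (K : ℕ) (x : Site) : d1 (d2 (v K)) x - d2 (d1 (v K)) x = 0 :=
  curl_grad_eq_zero (v K) x

/-- [folklore] **`Δ = ∂*∂` on scalars**: the five-point Laplacian is the backward divergence of the forward gradient,
`Δw(x) = [(∂₁w)(x) − (∂₁w)(x − e₁)] + [(∂₂w)(x) − (∂₂w)(x − e₂)]` — in the model, the source `f = Δ^ηλ` is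
`D^{η*}_{U₀}A` for `A = ∇^ηλ` ((1.146) with the bond → site adjoint (3.8)). -/
theorem lap_eq_div_grad (w : Site → ℚ) (x : Site) :
    lap w x = (d1 w x - d1 w (x.1 - 1, x.2)) + (d2 w x - d2 w (x.1, x.2 - 1)) := by
  obtain ⟨m, n⟩ := x
  simp only [lap, d1, d2, sub_add_cancel]
  ring

/-- [folklore] Sanity (kernel): at the site `(0, 1)` the plaquette field of `∇v₄` is `0` while the gradient of the
source is `−1/3` (`d1_lap_v`). -/
example : d1 (d2 (v 4)) (0, 1) - d2 (d1 (v 4)) (0, 1) = 0 ∧ d1 (lap (v 4)) (0, 1) = -1 / 3 := by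
  refine ⟨curl_grad_v_eq_zero 4 (0, 1), ?_⟩
  rw [d1_lap_v 4 (by norm_num)]
  norm_num

end Literature.MathematicalPhysics.QuantumFieldTheory.Balaban1983to89.B8HessianSupWitness
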